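import Mathlib
import Summits.AtomisticToContinuum.HydrodynamicLimit.Theorems.ImplosionDichotomyDenseExcursionCavityMatchingGlue

/-!
# Matching: pointwise existence of the smooth centre-regular resolvent solution off the real axis (theorem T6a)
# (crux `DenseExcursion`, line `sonic-cavity-renewal`, bricks for stub `stub_cavityResolventCk`)

Helper file (`--supports stmt-AtomisticToContinuum-12586`, line lead a2, stub-worker E1 for `stub_cavityResolventCk`,
theorem T6 of its decomposition). Two registered helpers:

* `cavity_matching_alternative` — THE MATCHING ALTERNATIVE (the algebraic heart of the Evans-function argument, stated
  with the local theory at the sonic point as a HYPOTHESIS so that it serves the off-axis, the real non-resonant and the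
  resonant cases alike). For a monatomic profile in the cavity tube, `Λ : ℂ`, `0 < δ ≤ 1`, suppose the resolvent equation
  has on `(−δ, δ)` a `C^∞` solution of the HOMOGENEOUS equations which is non-trivial there (the smooth branch at the
  repulsive sonic point), and, for the regular source `(f, g)`, a `C^∞` particular solution on `(−δ, δ)`. Then EITHER the
  sourced equation has a smooth centre-regular solution on all of `ℝ` (`IsRegularPair` + the equations everywhere), OR
  there is a smooth radial mode at `Λ`. Mechanism: the centre-regular branch on `x ≤ −1` (`centre_regular_branch`:
  particular + `a`·homogeneous) is continued to `x ≤ −δ/4` (`extend_regular_left`); the local sonic family is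
  particular + `t`·homogeneous; matching the two `ℂ²`-values at `x* = −δ/2` is a LINEAR map `T : ℂ² → ℂ²`,
  `T(a, t) = a·(centre hom.)(x*) − t·(sonic hom.)(x*)`. If `T` is injective it is surjective (`ℂ²` is finite-dimensional),
  the matching system is solvable and `glue_centre_sonic` produces the global regular solution; if not, a kernel vector
  `(a, t) ≠ 0` glues `a`·(centre homogeneous) to `t`·(sonic homogeneous) into a global regular solution of the homogeneous
  equations, non-trivial (at a point `x < −1` if `a ≠ 0`, by `exists_ne_zero_lt`; on `(−δ, δ)` if `a = 0 ≠ t`) — a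
  smooth radial mode at `Λ`.
* `cavity_resolvent_pointwise_offaxis` (T6a) — POINTWISE EXISTENCE OFF THE REAL AXIS: on the pinned window, under the
  stub's hypotheses (`IsMonatomicProfile`, `OrigProfileEqs`, `CavityTube`, `BoxPackage`, `RealBound`,
  `SonicConfinement`) and for the window rate `Λ₁` carrying a mode, every `Λ` with `Re Λ ≥ −1/5` and `|Im Λ| ≥ 1` and
  every regular source `(f, g)` admit a smooth centre-regular solution of `Λŵ − linW = f`, `Λŝ − linS = g` on `ℝ`: the
  local hypotheses are supplied by `sonic_smooth_branch_Ck_local` (T2, with `k = ⌈Re ν(Λ)⌉ + 1`, `R = ‖Λ‖`; the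
  homogeneous branch with `q(0) = 1` is non-trivial at `0`), and the mode alternative is excluded by exclusivity
  (`rate_eq_of_window`: a mode at `Λ` with `Re Λ > −1/4` has `Λ ∈ {Λ₁, r, 0} ⊆ ℝ`, impossible for `Im Λ ≠ 0`). No disc
  condition and no upper bound on `Re Λ` are needed off the axis; uniqueness is the landed `cavityResolvent_unique`.

Sources: folklore (Evans-function matching; Coddington–Levinson Ch. 3–4). Everything proved; no new definitions.
-/

noncomputable section

open Set Filter
open scoped Topology ContDiff

namespace Summit.AtomisticToContinuum.HydrodynamicLimit.Theorems.SonicCavityRenewal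

open Summit.AtomisticToContinuum.HydrodynamicLimit.Theorems.R2OneModeTwoConditions
open Literature.MathematicalPhysics.KineticTheory (V3)

/-! ## Linearity -/

/-- Centre-regular smooth pairs are closed under addition. [folklore] -/
theorem isRegularPair_add {ŵ ŝ ŵ' ŝ' : ℝ → ℂ} (h : IsRegularPair ŵ ŝ) (h' : IsRegularPair ŵ' ŝ') :
    IsRegularPair (fun x => ŵ x + ŵ' x) (fun x => ŝ x + ŝ' x) := by
  obtain ⟨hw, hs, F₁, F₂, G₁, G₂, hF₁, hF₂, hG₁, hG₂, hFG⟩ := h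
  obtain ⟨hw', hs', F₁', F₂', G₁', G₂', hF₁', hF₂', hG₁', hG₂', hFG'⟩ := h'
  refine ⟨hw.add hw', hs.add hs', fun y => F₁ y + F₁' y, fun y => F₂ y + F₂' y, fun y => G₁ y + G₁' y,
    fun y => G₂ y + G₂' y, hF₁.add hF₁', hF₂.add hF₂', hG₁.add hG₁', hG₂.add hG₂', fun y hy => ?_⟩
  obtain ⟨h1, h2, h3, h4⟩ := hFG y hy
  obtain ⟨h1', h2', h3', h4'⟩ := hFG' y hy
  refine ⟨?_, ?_, ?_, ?_⟩
  · rw [Complex.add_re, add_smul, h1, h1']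
  · rw [Complex.add_im, add_smul, h2, h2']
  · rw [Complex.add_re, mul_add, h3, h3']
  · rw [Complex.add_im, mul_add, h4, h4']

/-- Centre-regular smooth pairs are closed under complex scalars (`Re(aŵ) = Re a·Re ŵ − Im a·Im ŵ`, etc.). [folklore] -/
theorem isRegularPair_const_mul (a : ℂ) {ŵ ŝ : ℝ → ℂ} (h : IsRegularPair ŵ ŝ) :
    IsRegularPair (fun x => a * ŵ x) (fun x => a * ŝ x) := by
  obtain ⟨hw, hs, F₁, F₂, G₁, G₂, hF₁, hF₂, hG₁, hG₂, hFG⟩ := h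
  refine ⟨contDiff_const.mul hw, contDiff_const.mul hs, fun y => a.re • F₁ y - a.im • F₂ y,
    fun y => a.re • F₂ y + a.im • F₁ y, fun y => a.re * G₁ y - a.im * G₂ y, fun y => a.re * G₂ y + a.im * G₁ y,
    (hF₁.const_smul _).sub (hF₂.const_smul _), (hF₂.const_smul _).add (hF₁.const_smul _),
    (contDiff_const.mul hG₁).sub (contDiff_const.mul hG₂), (contDiff_const.mul hG₂).add (contDiff_const.mul hG₁),
    fun y hy => ?_⟩
  obtain ⟨h1, h2, h3, h4⟩ := hFG y hy
  refine ⟨?_, ?_, ?_, ?_⟩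
  · rw [Complex.mul_re, sub_smul, mul_smul, mul_smul, h1, h2]
  · rw [Complex.mul_im, add_smul, mul_smul, mul_smul, h1, h2]
  · show _ = a.re * G₁ y - a.im * G₂ y
    rw [Complex.mul_re, ← h3, ← h4]; ring
  · show _ = a.re * G₂ y + a.im * G₁ y
    rw [Complex.mul_im, ← h3, ← h4]; ring

/-- `linW`, `linS` are linear: `lin(u + a u', v + a v') = lin(u, v) + a·lin(u', v')` at points of differentiability.
[folklore] -/
theorem lin_add_const_mul {r : ℝ} {W S : ℝ → ℝ} {u v u' v' : ℝ → ℂ} (a : ℂ) {x : ℝ} (hu : DifferentiableAt ℝ u x)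
    (hv : DifferentiableAt ℝ v x) (hu' : DifferentiableAt ℝ u' x) (hv' : DifferentiableAt ℝ v' x) :
    linW r W S (fun y => u y + a * u' y) (fun y => v y + a * v' y) x = linW r W S u v x + a * linW r W S u' v' x ∧
      linS r W S (fun y => u y + a * u' y) (fun y => v y + a * v' y) x = linS r W S u v x + a * linS r W S u' v' x := by
  have d1 : deriv (fun y => u y + a * u' y) x = deriv u x + a * deriv u' x :=
    (hu.hasDerivAt.add (hu'.hasDerivAt.const_mul a)).deriv
  have d2 : deriv (fun y => v y + a * v' y) x = deriv v x + a * deriv v' x :=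
    (hv.hasDerivAt.add (hv'.hasDerivAt.const_mul a)).deriv
  unfold linW linS
  rw [d1, d2]
  constructor <;> ring

/-- THE MATCHING MAP: the linear map `ℂ² → ℂ²`, `(a, t) ↦ (a·A − t·B, a·C − t·D)`. [folklore] -/
theorem exists_matchingMap (A B C D : ℂ) :
    ∃ T : ℂ × ℂ →ₗ[ℂ] ℂ × ℂ, ∀ a t : ℂ, T (a, t) = (a * A - t * B, a * C - t * D) :=
  ⟨(LinearMap.fst ℂ ℂ ℂ).smulRight (A, C) - (LinearMap.snd ℂ ℂ ℂ).smulRight (B, D), fun a t => by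
    simp [LinearMap.smulRight_apply, Prod.smul_mk, smul_eq_mul]⟩

/-! ## The matching alternative -/

/-- **Registered helper `cavity_matching_alternative`: THE MATCHING ALTERNATIVE (solution or smooth radial mode).**
For a monatomic profile in the cavity tube, `Λ : ℂ`, `0 < δ ≤ 1`, a non-trivial `C^∞` solution of the homogeneous
resolvent equations on `(−δ, δ)`, a regular source `(f, g)` and a `C^∞` particular solution on `(−δ, δ)`: either the
sourced resolvent equation has a smooth centre-regular solution on `ℝ`, or there is a smooth radial mode at `Λ` (see the
module docstring). [folklore] -/
theorem cavity_matching_alternative : ∀ (r : ℝ) (W S : ℝ → ℝ), IsMonatomicProfile r W S → CavityTube r W S → ∀ (Λ : ℂ) (δ : ℝ), 0 < δ → δ ≤ 1 → (∃ ph qh : ℝ → ℂ, ContDiffOn ℝ ∞ ph (Set.Ioo (-δ) δ) ∧ ContDiffOn ℝ ∞ qh (Set.Ioo (-δ) δ) ∧ (∀ x ∈ Set.Ioo (-δ) δ, Λ * ph x - linW r W S ph qh x = 0 ∧ Λ * qh x - linS r W S ph qh x = 0) ∧ ∃ x ∈ Set.Ioo (-δ) δ, ph x ≠ 0 ∨ qh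 x ≠ 0) → ∀ (f g : ℝ → ℂ), IsRegularPair f g → (∃ pp qp : ℝ → ℂ, ContDiffOn ℝ ∞ pp (Set.Ioo (-δ) δ) ∧ ContDiffOn ℝ ∞ qp (Set.Ioo (-δ) δ) ∧ ∀ x ∈ Set.Ioo (-δ) δ, Λ * pp x - linW r W S pp qp x = f x ∧ Λ * qp x - linS r W S pp qp x = g x) → (∃ ŵ ŝ : ℝ → ℂ, IsRegularPair ŵ ŝ ∧ ∀ x, Λ * ŵ x - linW r W S ŵ ŝ x = f x ∧ Λ * ŝ x - linS r W S ŵ ŝ x = g x) ∨ (∃ ŵ ŝ : ℝ → ℂ, IsSmoothRadialMode r W S Λ ŵ ŝ) := by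
  intro r W S hP hT Λ δ hδ hδ1 hh f g hfg hp
  obtain ⟨ph, qh, hph, hqh, hsolh, x₁, hx₁, hne₁⟩ := hh
  obtain ⟨pp, qp, hpp, hqp, hsolp⟩ := hp
  have hf : ContDiff ℝ ∞ f := hfg.1
  have hg : ContDiff ℝ ∞ g := hfg.2.1
  have h0c : ContDiff ℝ ∞ (fun _ : ℝ => (0 : ℂ)) := contDiff_const
  -- the centre-regular branch on `x ≤ -1` and its continuation to `x ≤ -δ/4`
  obtain ⟨⟨wc, sc, hregc, hsolc, hnec⟩, hpart⟩ := centre_regular_branch r W S hP hT Λ 1 one_pos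
  obtain ⟨wp, sp, hregp, hsolp'⟩ := hpart f g hfg
  obtain ⟨x', hx', hne'⟩ := exists_ne_zero_lt hP hT zero_le_one hregc hsolc hnec
  have hsolc' : ∀ x ∈ Iic (-1 : ℝ), Λ * wc x - linW r W S wc sc x = (fun _ : ℝ => (0 : ℂ)) x ∧
      Λ * sc x - linS r W S wc sc x = (fun _ : ℝ => (0 : ℂ)) x := fun x hx =>
    ⟨sub_eq_zero.2 (hsolc x hx).1, sub_eq_zero.2 (hsolc x hx).2⟩
  obtain ⟨Wc, Sc, hregC, hsolC, eC, eC'⟩ := extend_regular_left hP hT Λ h0c h0c hregc (c := -1) (d := -(δ / 4))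
    (by linarith) (by linarith) hsolc'
  obtain ⟨Wp, Sp, hregP, hsolP, -, -⟩ := extend_regular_left hP hT Λ hf hg hregp (c := -1) (d := -(δ / 4))
    (by linarith) (by linarith) hsolp'
  -- differentiability facts
  have dWc : Differentiable ℝ Wc := hregC.1.differentiable (by simp)
  have dSc : Differentiable ℝ Sc := hregC.2.1.differentiable (by simp)
  have dWp : Differentiable ℝ Wp := hregP.1.differentiable (by simp)
  have dSp : Differentiable ℝ Sp := hregP.2.1.differentiable (by simp)
  have dI : ∀ {φ : ℝ → ℂ}, ContDiffOn ℝ ∞ φ (Ioo (-δ) δ) → ∀ x ∈ Ioo (-δ) δ, DifferentiableAt ℝ φ x :=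
    fun hφ x hx => (hφ.differentiableOn (by simp)).differentiableAt (Ioo_mem_nhds hx.1 hx.2)
  -- the matching map at `x* = -δ/2`
  set xs : ℝ := -(δ / 2) with hxs
  obtain ⟨T, hTmap⟩ := exists_matchingMap (Wc xs) (ph xs) (Sc xs) (qh xs)
  by_cases hinj : Function.Injective T
  · -- SOLVABLE MATCHING: the global regular solution
    left
    obtain ⟨⟨a, t⟩, hat⟩ := (LinearMap.injective_iff_surjective.1 hinj) (pp xs - Wp xs, qp xs - Sp xs)
    rw [hTmap, Prod.mk.injEq] at hat
    obtain ⟨e1, e2⟩ := hat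
    have hL : IsRegularPair (fun x => Wp x + a * Wc x) (fun x => Sp x + a * Sc x) :=
      isRegularPair_add hregP (isRegularPair_const_mul a hregC)
    have hsolL : ∀ x ∈ Iic (-(δ / 4)), Λ * (Wp x + a * Wc x) - linW r W S (fun y => Wp y + a * Wc y)
        (fun y => Sp y + a * Sc y) x = f x ∧ Λ * (Sp x + a * Sc x) - linS r W S (fun y => Wp y + a * Wc y)
        (fun y => Sp y + a * Sc y) x = g x := by
      intro x hx
      obtain ⟨l1, l2⟩ := lin_add_const_mul (r := r) (W := W) (S := S) a (dWp x) (dSp x) (dWc x) (dSc x)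
      obtain ⟨p1, p2⟩ := hsolP x hx
      obtain ⟨c1, c2⟩ := hsolC x hx
      rw [l1, l2]
      exact ⟨by linear_combination p1 + a * c1, by linear_combination p2 + a * c2⟩
    have hR1 : ContDiffOn ℝ ∞ (fun x => pp x + t * ph x) (Ioo (-δ) δ) := hpp.add (contDiffOn_const.mul hph)
    have hR2 : ContDiffOn ℝ ∞ (fun x => qp x + t * qh x) (Ioo (-δ) δ) := hqp.add (contDiffOn_const.mul hqh)
    have hsolR : ∀ x ∈ Ioo (-δ) δ, Λ * (pp x + t * ph x) - linW r W S (fun y => pp y + t * ph y)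
        (fun y => qp y + t * qh y) x = f x ∧ Λ * (qp x + t * qh x) - linS r W S (fun y => pp y + t * ph y)
        (fun y => qp y + t * qh y) x = g x := by
      intro x hx
      obtain ⟨l1, l2⟩ := lin_add_const_mul (r := r) (W := W) (S := S) t (dI hpp x hx) (dI hqp x hx) (dI hph x hx)
        (dI hqh x hx)
      obtain ⟨p1, p2⟩ := hsolp x hx
      obtain ⟨c1, c2⟩ := hsolh x hx
      rw [l1, l2]
      exact ⟨by linear_combination p1 + t * c1, by linear_combination p2 + t * c2⟩
    obtain ⟨ŵ, ŝ, hreg, hsol, -⟩ := glue_centre_sonic r W S hP hT Λ f g hf hg δ hδ hδ1 _ _ _ _ hL hsolL hR1 hR2 hsolR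
      (by linear_combination e1) (by linear_combination e2)
    exact ⟨ŵ, ŝ, hreg, hsol⟩
  · -- A KERNEL VECTOR: a smooth radial mode at `Λ`
    right
    obtain ⟨⟨a, t⟩, hT0, hne⟩ : ∃ v : ℂ × ℂ, T v = 0 ∧ v ≠ 0 := by
      by_contra h
      push Not at h
      exact hinj ((injective_iff_map_eq_zero T).2 h)
    rw [hTmap, Prod.mk_eq_zero] at hT0
    obtain ⟨e1, e2⟩ := hT0
    have hL : IsRegularPair (fun x => a * Wc x) (fun x => a * Sc x) := isRegularPair_const_mul a hregC
    have hsolL : ∀ x ∈ Iic (-(δ / 4)), Λ * (a * Wc x) - linW r W S (fun y => a * Wc y) (fun y => a * Sc y) x = 0 ∧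
        Λ * (a * Sc x) - linS r W S (fun y => a * Wc y) (fun y => a * Sc y) x = 0 := by
      intro x hx
      obtain ⟨l1, l2⟩ := lin_const_mul (r := r) (W := W) (S := S) a (dWc x) (dSc x)
      obtain ⟨c1, c2⟩ := hsolC x hx
      rw [l1, l2]
      exact ⟨by linear_combination a * c1, by linear_combination a * c2⟩
    have hR1 : ContDiffOn ℝ ∞ (fun x => t * ph x) (Ioo (-δ) δ) := contDiffOn_const.mul hph
    have hR2 : ContDiffOn ℝ ∞ (fun x => t * qh x) (Ioo (-δ) δ) := contDiffOn_const.mul hqh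
    have hsolR : ∀ x ∈ Ioo (-δ) δ, Λ * (t * ph x) - linW r W S (fun y => t * ph y) (fun y => t * qh y) x = 0 ∧
        Λ * (t * qh x) - linS r W S (fun y => t * ph y) (fun y => t * qh y) x = 0 := by
      intro x hx
      obtain ⟨l1, l2⟩ := lin_const_mul (r := r) (W := W) (S := S) t (dI hph x hx) (dI hqh x hx)
      obtain ⟨c1, c2⟩ := hsolh x hx
      rw [l1, l2]
      exact ⟨by linear_combination t * c1, by linear_combination t * c2⟩
    obtain ⟨ŵ, ŝ, hreg, hsol, ew, es, ew', es'⟩ := glue_centre_sonic r W S hP hT Λ _ _ h0c h0c δ hδ hδ1 _ _ _ _ hL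
      hsolL hR1 hR2 hsolR (by linear_combination e1) (by linear_combination e2)
    refine ⟨ŵ, ŝ, hreg, ?_, fun x => ?_⟩
    · -- non-triviality
      by_cases ha : a = 0
      · have ht : t ≠ 0 := fun ht => hne (Prod.mk_eq_zero.2 ⟨ha, ht⟩)
        refine ⟨x₁, ?_⟩
        rw [ew' hx₁, es' hx₁]
        rcases hne₁ with h1 | h1
        · exact Or.inl (mul_ne_zero ht h1)
        · exact Or.inr (mul_ne_zero ht h1)
      · have hx'δ : x' ∈ Iio (-(δ / 4)) := show x' < -(δ / 4) by linarith
        refine ⟨x', ?_⟩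
        rw [ew hx'δ, es hx'δ]
        simp only
        rw [eC hx', eC' hx']
        rcases hne' with h1 | h1
        · exact Or.inl (mul_ne_zero ha h1)
        · exact Or.inr (mul_ne_zero ha h1)
    · obtain ⟨h1, h2⟩ := hsol x
      exact ⟨sub_eq_zero.1 h1, sub_eq_zero.1 h2⟩

/-! ## T6a: pointwise existence off the real axis -/

/-- **Registered helper `cavity_resolvent_pointwise_offaxis` (T6a): POINTWISE EXISTENCE OF THE SMOOTH CENTRE-REGULAR
RESOLVENT SOLUTION OFF THE REAL AXIS.** On the pinned window, under the stub's hypotheses and for the window rate `Λ₁`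
carrying a smooth radial mode: for every `Λ` with `Re Λ ≥ −1/5`, `|Im Λ| ≥ 1` and every regular source `(f, g)` the
resolvent equation `Λŵ − linW = f`, `Λŝ − linS = g` has a smooth centre-regular solution on `ℝ` (local sonic data from
`sonic_smooth_branch_Ck_local`, matching by `cavity_matching_alternative`, the mode alternative excluded by
`rate_eq_of_window` since `Λ₁, r, 0` are real). [folklore] -/
theorem cavity_resolvent_pointwise_offaxis : ∀ (r : ℝ) (W S : ℝ → ℝ), (17307 / 15625 : ℝ) ≤ r → r ≤ 697 / 625 → IsMonatomicProfile r W S → OrigProfileEqs r W S → CavityTube r W S → BoxPackage r W S → RealBound r W S → SonicConfinement r W S → ∀ Λ₁ : ℝ, 6 * (r - 1) < Λ₁ → Λ₁ < 9 * (r - 1) → (∃ ŵ ŝ : ℝ → ℂ, IsSmoothRadialMode r W S (Λ₁ : ℂ) ŵ ŝ) → ∀ Λ : ℂ, -(1 / 5 : ℝ) ≤ Λ.re → 1 ≤ |Λ.im| → ∀ (f g : ℝ → ℂ), IsRegularPair f g → ∃ ŵ ŝ : ℝ → ℂ, IsRegularPair ŵ ŝ ∧ ∀ x, Λ * ŵ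 x - linW r W S ŵ ŝ x = f x ∧ Λ * ŝ x - linS r W S ŵ ŝ x = g x := by
  intro r W S h1 h2 hP hE hT hbox hre him Λ₁ h6 h9 hmode Λ hΛre hΛim f g hfg
  have h2' : r ≤ 89409 / 80000 := h2.trans (by norm_num)
  -- the number of derivatives: `Re ν(Λ) ≤ k - 1`
  set ν : ℂ := ((((2 / 3 * deriv W 0 + 2 * deriv S 0 + 2 * W 0 + 4 * S 0 - r : ℝ) : ℂ) - Λ) /
    ((-(deriv W 0 + deriv S 0) : ℝ) : ℂ)) with hν
  obtain ⟨k, hk⟩ : ∃ k : ℕ, ν.re ≤ (k : ℝ) - 1 :=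
    ⟨⌈ν.re⌉₊ + 1, by push_cast; linarith [Nat.le_ceil ν.re]⟩
  obtain ⟨δ₀, hδ₀, K, -, hloc⟩ := sonic_smooth_branch_Ck_local r W S h1 h2' hP hE hT k ‖Λ‖
  obtain ⟨ph, qh, hph, hqh, hq1, hsolh, -⟩ :=
    (hloc Λ le_rfl hk hΛim (fun _ => 0) (fun _ => 0) contDiff_const contDiff_const 1).1
  obtain ⟨pp, qp, hpp, hqp, -, hsolp, -⟩ := (hloc Λ le_rfl hk hΛim f g hfg.1 hfg.2.1 0).1
  -- restrict to `δ = min δ₀ 1`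
  set δ : ℝ := min δ₀ 1 with hδ
  have hδpos : 0 < δ := lt_min hδ₀ one_pos
  have hsub : Ioo (-δ) δ ⊆ Ioo (-δ₀) δ₀ := Ioo_subset_Ioo (neg_le_neg (min_le_left _ _)) (min_le_left _ _)
  have hne0 : ph 0 ≠ 0 ∨ qh 0 ≠ 0 := by
    by_contra h
    push Not at h
    rw [h.1, h.2, mul_zero, sub_zero] at hq1
    exact zero_ne_one hq1
  rcases cavity_matching_alternative r W S hP hT Λ δ hδpos (min_le_right _ _)
      ⟨ph, qh, hph.mono hsub, hqh.mono hsub, fun x hx => hsolh x (hsub hx), 0, ⟨by linarith, hδpos⟩, hne0⟩ f g hfg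
      ⟨pp, qp, hpp.mono hsub, hqp.mono hsub, fun x hx => hsolp x (hsub hx)⟩ with hsol | ⟨ŵ, ŝ, hm⟩
  · exact hsol
  · exfalso
    have hΛ4 : -(1 / 4 : ℝ) < Λ.re := by linarith
    have him0 : Λ.im = 0 := by
      rcases rate_eq_of_window r W S h2' hbox hre him Λ₁ h6 h9 hmode Λ hΛ4 ⟨ŵ, ŝ, hm⟩ with h | h | h <;>
        simp [h]
    rw [him0, abs_zero] at hΛim
    exact absurd hΛim (by norm_num)

end Summit.AtomisticToContinuum.HydrodynamicLimit.Theorems.SonicCavityRenewal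

end
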